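import Summits.CriticalPhenomena.PercolationContinuityZ3.Theorems.PercNearOneGluingNoHeavyLowerTailSahiCombTriWTopFibre
import Summits.CriticalPhenomena.PercolationContinuityZ3.Theorems.PercNearOneGluingNoHeavyLowerTailSahiCombTriWSharp

/-!
# The rung `J = X \ {0̂}` of the top-down filtration (JP) at `a = 2` is a THEOREM: `T_1̂ + T_p + T_q ≥ 0`

Support file of the one-cut programme (crux `NoHeavyLowerTail`, stmt-CriticalPhenomena-4575; cell `prim-masterthm`, seat P5 gen 13;
report `P5-LORENTZIAN-TEST.md` §18).

Report §16.2 introduced the regrouped summands `T_x(P) = FiveUpSet.topTerm P F G x` of the one-cube triangle functional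
`TRI_W(a) = Σ_x T_x` (`…SahiCombTriWTopFibre`, `sum_topTerm_eq_triW`) and the census-clean conjecture (JP): `Σ_{x ∈ J} T_x(P) ≥ 0` for every
up-set `J` of the index cube.  The top rung `J = {1̂}` is the top-fibre theorem (`topTerm_univ_nonneg`).  This file proves the NEXT rung at
`a = 2`, `J = {p, q, 1̂} = X \ {0̂}`, for which the gen-11 pointwise LP had only a fooling value (`−1/5`):

* **`FiveUpSet.rung_two_le`** — for an up-set `P` and two DIAMONDS of up-sets `F₀ ⊆ Fp, Fq ⊆ F₁`, `G₀ ⊆ Gp, Gq ⊆ G₁` (the values of two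
  monotone families on the index square `0̂ < p, q < 1̂`):
  `0 ≤ T(F₁,G₁;F₀,G₀) + T(Fp,Gp;Fq,Gq) + T(Fq,Gq;Fp,Gp)`, where
  `T(A,B;A',B') = 2·#(P∩A∩B) + #(P∩refl A∩refl B') − #(P∩B∩refl A') − #(P∩A∩refl B') − #(P∩refl(A∩B))` is `topTerm` at the index
  with `(F x, G x, F xᶜ, G xᶜ) = (A, B, A', B')`.
  PROOF (a pointwise certificate found by LP, kit j129009, and checked exactly): the sum dominates, point by point of `P`, the three
  TOP-FIBRE inequalities `topFibre_le` for the nested pairs `(F₀ ⊆ Fp; G₀ ⊆ Gp)`, `(Fp ∩ Fq ⊆ Fq; Gp ∩ Gq ⊆ Gq)`,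
  `(Fp ∪ Fq ⊆ F₁; Gp ∪ Gq ⊆ G₁)` — a maximal chain of the diamond whose three shells tile `F₁ \ F₀` — and the remainder is a sum over
  `w ∈ P` of a function of the four diamond positions of `w, wᶜ` in `F, G` that is non-negative in all `6⁴ = 1296` cases (`diamond_pos` codes the
  position of a point in a diamond by `Fin 6`; then kernel `decide`).
* `diamond_pos` — the six positions of a point in a diamond of up-sets; `card_inter_inter_eq_sum`, `card_inter_eq_sum` — counting as sums
  of indicators.
With `T_0̂` added the sum is `TRI_W(2)` itself (`FiveUpSet.TriWIneq` at `a = 2`), which stays OPEN: the same LP over the extended atom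
library (thin-edge/top-fibre atoms on all nested pairs of the chains `F₀ ⊆ Fp∩Fq ⊆ Fp,Fq ⊆ Fp∪Fq ⊆ F₁` and Kleitman atoms) is infeasible
for `J = X` with fooling value `−2/7` (kit j129006; report §18).
HONEST LABEL: one new rung of (JP) at `a = 2`, proved from the top-fibre theorem by a machine-found, kernel-checked case analysis; it does
not prove `TriWIneq`. [this work]
-/

namespace Summit.CriticalPhenomena.PercolationContinuityZ3.Theorems

namespace FiveUpSet

open Finset

variable {γ : Type} [DecidableEq γ] [Fintype γ]

/-! ### Counting as sums of indicators -/

omit [Fintype γ] in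
/-- `#(P ∩ A ∩ B) = Σ_{w ∈ P} [w ∈ A ∧ w ∈ B]` over `ℤ`. [this work] -/
theorem card_inter_inter_eq_sum (P A B : Finset (Finset γ)) :
    ((P ∩ A ∩ B).card : ℤ) = ∑ w ∈ P, (if w ∈ A ∧ w ∈ B then (1 : ℤ) else 0) := by
  rw [Finset.sum_boole]
  congr 2
  ext w; simp

omit [Fintype γ] in
/-- `#(P ∩ X) = Σ_{w ∈ P} [w ∈ X]` over `ℤ`. [this work] -/
theorem card_inter_eq_sum (P X : Finset (Finset γ)) :
    ((P ∩ X).card : ℤ) = ∑ w ∈ P, (if w ∈ X then (1 : ℤ) else 0) := by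
  rw [Finset.sum_boole, Finset.filter_mem_eq_inter]

/-! ### Positions in a diamond of up-sets -/

omit [Fintype γ] in
/-- The position of a point `w` in a diamond `F₀ ⊆ Fp, Fq ⊆ F₁`, coded in `Fin 6`
(`0`: outside `F₁`; `1`: in `F₁` only; `2`: in `Fp \ Fq`; `3`: in `Fq \ Fp`; `4`: in `Fp ∩ Fq \ F₀`; `5`: in `F₀`):
the four memberships of `w` are read off from the code. [this work] -/
theorem diamond_pos {F₀ Fp Fq F₁ : Finset (Finset γ)} (h0p : F₀ ⊆ Fp) (h0q : F₀ ⊆ Fq) (hp1 : Fp ⊆ F₁) (hq1 : Fq ⊆ F₁)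
    (w : Finset γ) : ∃ s : Fin 6, (w ∈ F₀ ↔ s = 5) ∧ (w ∈ Fp ↔ (s = 2 ∨ s = 4 ∨ s = 5)) ∧
      (w ∈ Fq ↔ (s = 3 ∨ s = 4 ∨ s = 5)) ∧ (w ∈ F₁ ↔ s ≠ 0) := by
  by_cases h0 : w ∈ F₀
  · exact ⟨5, by simp [h0, h0p h0, h0q h0, hp1 (h0p h0)]⟩
  · by_cases hp : w ∈ Fp
    · by_cases hq : w ∈ Fq
      · exact ⟨4, by simp [h0, hp, hq, hp1 hp]⟩
      · exact ⟨2, by simp [h0, hp, hq, hp1 hp]⟩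
    · by_cases hq : w ∈ Fq
      · exact ⟨3, by simp [h0, hp, hq, hq1 hq]⟩
      · by_cases h1 : w ∈ F₁
        · exact ⟨1, by simp [h0, hp, hq, h1]⟩
        · exact ⟨0, by simp [h0, hp, hq, h1]⟩

/-! ### The rung theorem -/

/-- **The rung `J = {p,q,1̂}` of (JP) at `a = 2`.**  For an up-set `P` and two diamonds of up-sets `F₀ ⊆ Fp, Fq ⊆ F₁`, `G₀ ⊆ Gp, Gq ⊆ G₁`
of a finite cube: `0 ≤ T(F₁,G₁;F₀,G₀) + T(Fp,Gp;Fq,Gq) + T(Fq,Gq;Fp,Gp)` with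
`T(A,B;A',B') = 2·#(P∩A∩B) + #(P∩refl A∩refl B') − #(P∩B∩refl A') − #(P∩A∩refl B') − #(P∩refl(A∩B))`.
Three top-fibre inequalities plus a 1296-case pointwise remainder. [this work] -/
theorem rung_two_le (P F₀ Fp Fq F₁ G₀ Gp Gq G₁ : Finset (Finset γ)) (hP : IsUpperSet (P : Set (Finset γ)))
    (hF₀ : IsUpperSet (F₀ : Set (Finset γ))) (hFp : IsUpperSet (Fp : Set (Finset γ))) (hFq : IsUpperSet (Fq : Set (Finset γ)))
    (hF₁ : IsUpperSet (F₁ : Set (Finset γ))) (hG₀ : IsUpperSet (G₀ : Set (Finset γ))) (hGp : IsUpperSet (Gp : Set (Finset γ)))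
    (hGq : IsUpperSet (Gq : Set (Finset γ))) (hG₁ : IsUpperSet (G₁ : Set (Finset γ)))
    (hF0p : F₀ ⊆ Fp) (hF0q : F₀ ⊆ Fq) (hFp1 : Fp ⊆ F₁) (hFq1 : Fq ⊆ F₁)
    (hG0p : G₀ ⊆ Gp) (hG0q : G₀ ⊆ Gq) (hGp1 : Gp ⊆ G₁) (hGq1 : Gq ⊆ G₁) :
    0 ≤ (2 * ((P ∩ F₁ ∩ G₁).card : ℤ) + (P ∩ refl F₁ ∩ refl G₀).card - (P ∩ G₁ ∩ refl F₀).card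
        - (P ∩ F₁ ∩ refl G₀).card - (P ∩ refl (F₁ ∩ G₁)).card)
      + (2 * ((P ∩ Fp ∩ Gp).card : ℤ) + (P ∩ refl Fp ∩ refl Gq).card - (P ∩ Gp ∩ refl Fq).card
        - (P ∩ Fp ∩ refl Gq).card - (P ∩ refl (Fp ∩ Gp)).card)
      + (2 * ((P ∩ Fq ∩ Gq).card : ℤ) + (P ∩ refl Fq ∩ refl Gp).card - (P ∩ Gq ∩ refl Fp).card
        - (P ∩ Fq ∩ refl Gp).card - (P ∩ refl (Fq ∩ Gq)).card) := by
  -- the three top-fibre inequalities along the chain F₀ ⊆ Fp, Fp ∩ Fq ⊆ Fq, Fp ∪ Fq ⊆ F₁ (and the same chain for G)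
  have hMF : IsUpperSet ((Fp ∩ Fq : Finset (Finset γ)) : Set (Finset γ)) := by rw [coe_inter]; exact hFp.inter hFq
  have hMG : IsUpperSet ((Gp ∩ Gq : Finset (Finset γ)) : Set (Finset γ)) := by rw [coe_inter]; exact hGp.inter hGq
  have hJF : IsUpperSet ((Fp ∪ Fq : Finset (Finset γ)) : Set (Finset γ)) := by rw [coe_union]; exact hFp.union hFq
  have hJG : IsUpperSet ((Gp ∪ Gq : Finset (Finset γ)) : Set (Finset γ)) := by rw [coe_union]; exact hGp.union hGq
  have h1 := topFibre_le P F₀ Fp G₀ Gp hP hF₀ hFp hG₀ hGp hF0p hG0p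
  have h2 := topFibre_le P (Fp ∩ Fq) Fq (Gp ∩ Gq) Gq hP hMF hFq hMG hGq inter_subset_right inter_subset_right
  have h3 := topFibre_le P (Fp ∪ Fq) F₁ (Gp ∪ Gq) G₁ hP hJF hF₁ hJG hG₁ (union_subset hFp1 hFq1) (union_subset hGp1 hGq1)
  have h1' : ((P ∩ Gp ∩ refl F₀).card : ℤ) + (P ∩ Fp ∩ refl G₀).card + (P ∩ refl (Fp ∩ (Gp \ G₀))).card
      + (P ∩ refl ((Fp \ F₀) ∩ Gp)).card ≤ 2 * ((P ∩ Fp ∩ Gp).card : ℤ) := by exact_mod_cast h1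
  have h2' : ((P ∩ Gq ∩ refl (Fp ∩ Fq)).card : ℤ) + (P ∩ Fq ∩ refl (Gp ∩ Gq)).card + (P ∩ refl (Fq ∩ (Gq \ (Gp ∩ Gq)))).card
      + (P ∩ refl ((Fq \ (Fp ∩ Fq)) ∩ Gq)).card ≤ 2 * ((P ∩ Fq ∩ Gq).card : ℤ) := by exact_mod_cast h2
  have h3' : ((P ∩ G₁ ∩ refl (Fp ∪ Fq)).card : ℤ) + (P ∩ F₁ ∩ refl (Gp ∪ Gq)).card + (P ∩ refl (F₁ ∩ (G₁ \ (Gp ∪ Gq)))).card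
      + (P ∩ refl ((F₁ \ (Fp ∪ Fq)) ∩ G₁)).card ≤ 2 * ((P ∩ F₁ ∩ G₁).card : ℤ) := by exact_mod_cast h3
  -- the pointwise remainder
  have hR : 0 ≤ ((P ∩ refl F₁ ∩ refl G₀).card : ℤ) + ((P ∩ refl Fp ∩ refl Gq).card : ℤ) + ((P ∩ refl Fq ∩ refl Gp).card : ℤ) + ((P ∩ Gp ∩ refl F₀).card : ℤ) + ((P ∩ Fp ∩ refl G₀).card : ℤ) + ((P ∩ Gq ∩ refl (Fp ∩ Fq)).card : ℤ) + ((P ∩ Fq ∩ refl (Gp ∩ Gq)).card : ℤ) + ((P ∩ G₁ ∩ refl (Fp ∪ Fq)).card : ℤ) + ((P ∩ F₁ ∩ refl (Gp ∪ Gq)).card : ℤ) + ((P ∩ refl (Fp ∩ (Gp \ G₀))).card : ℤ) + ((P ∩ refl ((Fp \ F₀) ∩ Gp)).card : ℤ) + ((P ∩ refl (Fq ∩ (Gq \ (Gp ∩ Gq)))).card : ℤ) + ((P ∩ refl ((Fq \ (Fp ∩ Fq)) ∩ Gq)).card : ℤ) + ((P ∩ refl (F₁ ∩ (G₁ \ (Gp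 ∪ Gq)))).card : ℤ) + ((P ∩ refl ((F₁ \ (Fp ∪ Fq)) ∩ G₁)).card : ℤ)
        - ((P ∩ G₁ ∩ refl F₀).card : ℤ) - ((P ∩ F₁ ∩ refl G₀).card : ℤ) - ((P ∩ Gp ∩ refl Fq).card : ℤ) - ((P ∩ Fp ∩ refl Gq).card : ℤ) - ((P ∩ Gq ∩ refl Fp).card : ℤ) - ((P ∩ Fq ∩ refl Gp).card : ℤ) - ((P ∩ refl (F₁ ∩ G₁)).card : ℤ) - ((P ∩ refl (Fp ∩ Gp)).card : ℤ) - ((P ∩ refl (Fq ∩ Gq)).card : ℤ) := by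
    rw [card_inter_inter_eq_sum P (refl F₁) (refl G₀), card_inter_inter_eq_sum P (refl Fp) (refl Gq), card_inter_inter_eq_sum P (refl Fq) (refl Gp), card_inter_inter_eq_sum P (Gp) (refl F₀), card_inter_inter_eq_sum P (Fp) (refl G₀), card_inter_inter_eq_sum P (Gq) (refl (Fp ∩ Fq)), card_inter_inter_eq_sum P (Fq) (refl (Gp ∩ Gq)), card_inter_inter_eq_sum P (G₁) (refl (Fp ∪ Fq)), card_inter_inter_eq_sum P (F₁) (refl (Gp ∪ Gq)), card_inter_inter_eq_sum P (G₁) (refl F₀), card_inter_inter_eq_sum P (F₁) (refl G₀), card_inter_inter_eq_sum P (Gp) (refl Fq), card_inter_inter_eq_sum P (Fp) (refl Gq), card_inter_inter_eq_sum P (Gq) (refl Fp), card_inter_inter_eq_sum P (Fq) (refl Gp),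
      card_inter_eq_sum P (refl (Fp ∩ (Gp \ G₀))), card_inter_eq_sum P (refl ((Fp \ F₀) ∩ Gp)), card_inter_eq_sum P (refl (Fq ∩ (Gq \ (Gp ∩ Gq)))), card_inter_eq_sum P (refl ((Fq \ (Fp ∩ Fq)) ∩ Gq)), card_inter_eq_sum P (refl (F₁ ∩ (G₁ \ (Gp ∪ Gq)))), card_inter_eq_sum P (refl ((F₁ \ (Fp ∪ Fq)) ∩ G₁)), card_inter_eq_sum P (refl (F₁ ∩ G₁)), card_inter_eq_sum P (refl (Fp ∩ Gp)), card_inter_eq_sum P (refl (Fq ∩ Gq))]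
    simp only [mem_inter, mem_refl, mem_sdiff, mem_union, ← Finset.sum_add_distrib, ← Finset.sum_sub_distrib]
    refine Finset.sum_nonneg (fun w _ => ?_)
    -- classify `w` and `wᶜ` in the two diamonds and decide the 6⁴ = 1296 cases
    obtain ⟨s₁, -, ap, aq, a1⟩ := diamond_pos hF0p hF0q hFp1 hFq1 w
    obtain ⟨s₂, -, bp, bq, b1⟩ := diamond_pos hG0p hG0q hGp1 hGq1 w
    obtain ⟨s₃, c0, cp, cq, c1⟩ := diamond_pos hF0p hF0q hFp1 hFq1 wᶜ
    obtain ⟨s₄, d0, dp, dq, d1⟩ := diamond_pos hG0p hG0q hGp1 hGq1 wᶜ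
    simp only [ap, aq, a1, bp, bq, b1, c0, cp, cq, c1, d0, dp, dq, d1]
    clear ap aq a1 bp bq b1 c0 cp cq c1 d0 dp dq d1
    revert s₁ s₂ s₃ s₄
    decide
  linarith [hR, h1', h2', h3']

/-- **The rung theorem in the indexed language of `topTerm`** (`…SahiCombTriWTopFibre`): for an index cube `Finset β` with
`Fintype.card β = 2` and atoms `a ≠ b`, an up-set `P` and monotone families `F, G` of up-sets,
`0 ≤ topTerm P F G univ + topTerm P F G {a} + topTerm P F G {b}` — the (JP) partial sum over the up-set `J = {{a}, {b}, univ}` of the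
index cube.  (Adding `topTerm P F G ∅` gives `triW P F G`, whose sign is the open `TriWIneq`.) [this work] -/
theorem topTerm_rung_two_nonneg {β : Type} [DecidableEq β] [Fintype β] {a b : β} (hab : a ≠ b)
    (hu : (univ : Finset β) = {a, b}) (P : Finset (Finset γ)) (F G : Finset β → Finset (Finset γ))
    (hP : IsUpperSet (P : Set (Finset γ))) (hF : ∀ x, IsUpperSet (F x : Set (Finset γ)))
    (hG : ∀ x, IsUpperSet (G x : Set (Finset γ))) (hFm : Monotone F) (hGm : Monotone G) :
    0 ≤ topTerm P F G univ + topTerm P F G {a} + topTerm P F G {b} := by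
  have cab : ({a} : Finset β)ᶜ = {b} := compl_singleton_eq_of_univ hab hu
  have cba : ({b} : Finset β)ᶜ = {a} := by
    have hu' : (univ : Finset β) = {b, a} := by rw [hu, pair_comm]
    exact compl_singleton_eq_of_univ hab.symm hu'
  have h := rung_two_le P (F ∅) (F {a}) (F {b}) (F univ) (G ∅) (G {a}) (G {b}) (G univ) hP
    (hF ∅) (hF {a}) (hF {b}) (hF univ) (hG ∅) (hG {a}) (hG {b}) (hG univ)
    (hFm (empty_subset _)) (hFm (empty_subset _)) (hFm (subset_univ _)) (hFm (subset_univ _))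
    (hGm (empty_subset _)) (hGm (empty_subset _)) (hGm (subset_univ _)) (hGm (subset_univ _))
  simp only [topTerm, compl_univ, cab, cba]
  linarith [h]

end FiveUpSet

end Summit.CriticalPhenomena.PercolationContinuityZ3.Theorems
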